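import Mathlib
import HarnessLib
import Summits.Parity.Statement
import Summits.Parity.GeneralizedHardyLittlewood.Theses.ShiftTauberian
import Summits.Parity.GeneralizedHardyLittlewood.Theses.PrimeDeterminantCells
import Summits.Parity.GeneralizedHardyLittlewood.Theorems.LeeYangFibresFibrationLemmaFinal

/-!
# The fibration lift (support item stmt-Parity-18286)

The one-dimensional case of Green–Tao Conj. 1.2 (d = 1, all t, uniform in L) implies
`GeneralizedHardyLittlewood` (all d): this is the fibration lemma proved in the tree as
`Theorems.FibrationGlue.generalizedHardyLittlewood_of_dimOne`.  Both route files that carry the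
support binder `FibrationLift` (route-Parity-ShiftTauberian, route-Parity-PrimeDeterminantCells) inline
the same antecedent verbatim, so each is closed in one line.
-/

namespace Summit.Parity.GeneralizedHardyLittlewood.Theses.ShiftTauberian

/-- Support item stmt-Parity-18286 for route-Parity-ShiftTauberian: the d = 1 case of GHL (uniform in
L) implies GHL, by the tree's fibration lemma `FibrationGlue.generalizedHardyLittlewood_of_dimOne`. -/
theorem fibrationLift_proof : FibrationLift :=
  fun h => Theorems.FibrationGlue.generalizedHardyLittlewood_of_dimOne h

end Summit.Parity.GeneralizedHardyLittlewood.Theses.ShiftTauberian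

namespace Summit.Parity.GeneralizedHardyLittlewood.Theses.PrimeDeterminantCells

/-- Support item stmt-Parity-18286 for route-Parity-PrimeDeterminantCells: the d = 1 case of GHL
(uniform in L) implies GHL, by the tree's fibration lemma
`FibrationGlue.generalizedHardyLittlewood_of_dimOne`. -/
theorem fibrationLift_proof : FibrationLift :=
  fun h => Theorems.FibrationGlue.generalizedHardyLittlewood_of_dimOne h

end Summit.Parity.GeneralizedHardyLittlewood.Theses.PrimeDeterminantCells
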